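import Literature.Analysis.PDE.LoewnerNirenbergKelvin
import Literature.Analysis.FluidPDE.RadialCalculus
import Literature.Analysis.FluidPDE.SverakLandauClassification

/-!
# Route `LandauTail`, item `HomSteadyProfileExists` (stmt-NavierStokesRegularity-1951) — helper 1:
# pointwise Laplacian calculus off the origin and `Δβ = β ∂ₐβ` for `β = 2/(c|x| − ⟪a,x⟫)`

Support file (`--supports stmt-NavierStokesRegularity-1951`) for the verification that Landau's
solutions `landauAxisField a c` / `landauAxisPressure a c` (Literature/Analysis/FluidPDE/
SverakLandauClassification, LandauSolutions) solve the steady Navier–Stokes equations off the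
origin (Landau 1944; Lemarié-Rieusset 2016, Thm 10.13; Karch–Pilarczyk 2011, §1), which the tree
records as "deliberately NOT here" in `LandauSolutions.lean`.

Writing `U = (P/2) x + β a` with `β = 2/(c|x| − ⟪a,x⟫)` and `P = landauAxisPressure a c = −2∂ₐβ`,
the whole verification reduces to first-order calculus plus ONE second-order identity,
`Δβ = β ∂ₐβ` on `ℝ³ ∖ {0}` (`laplacian_landauBeta`), proved here from

* a pointwise chain rule `Δ(g ∘ f)(x) = g''(f x) Σᵢ (∂ᵢf)² + g'(f x) Δf(x)` for `f` of class `C²`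
  AT `x` only (`laplacian_comp_deriv_apply`; the tree's versions are global or radial),
* `Δ|x| = (n − 1)/|x|`, `Δ⟪a,·⟫ = 0`, whence `Δ(c|x| − ⟪a,x⟫) = 2c/|x|` in `ℝ³`, and
  `D(c|x| − ⟪a,x⟫) = ⟪(c/|x|) x − a, ·⟫`.

All statements are pointwise at `x ≠ 0`; nothing is assumed globally smooth.

References: L. D. Landau, Dokl. Akad. Nauk SSSR 43 (1944) 286–288; P. G. Lemarié-Rieusset,
*The Navier–Stokes problem in the 21st century* (2016), Thm 10.13; G. Karch, D. Pilarczyk,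
Arch. Ration. Mech. Anal. 202 (2011), §1.
-/

noncomputable section

open Set Filter Module
open scoped Laplacian InnerProductSpace RealInnerProductSpace Topology
open Literature.Analysis.PDE.LoewnerNirenberg Literature.Analysis.FluidPDE

-- the summit namespace `…NavierStokesRegularity.NavierStokesRegularity…` is the tree convention
set_option linter.dupNamespace false

namespace Summit.NavierStokesRegularity.NavierStokesRegularity.Theorems.LandauTail

variable {E : Type*} [NormedAddCommGroup E] [InnerProductSpace ℝ E] [FiniteDimensional ℝ E]

/-! ### A pointwise chain rule for the Laplacian of `g ∘ f`, `g : ℝ → ℝ` -/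

/-- **Chain rule for the Laplacian through a scalar function**, pointwise version: if `f : E → ℝ`
is `C²` at `x`, `g` has derivative `g₁` on an open set `U ∋ f x` and `g₁` has derivative `g₂`
at `f x`, then `Δ(g ∘ f)(x) = g₂ Σᵢ (∂ᵢ f(x))² + g₁(f x) Δf(x)` (orthonormal basis `b`). [folklore] -/
theorem laplacian_comp_deriv_apply {ι : Type*} [Fintype ι] (b : OrthonormalBasis ι ℝ E)
    {f : E → ℝ} {x : E} (hf : ContDiffAt ℝ 2 f x) {g g₁ : ℝ → ℝ} {g₂ : ℝ} {U : Set ℝ}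
    (hU : IsOpen U) (hg : ∀ σ ∈ U, HasDerivAt g (g₁ σ) σ) (hfx : f x ∈ U)
    (hg₁ : HasDerivAt g₁ g₂ (f x)) :
    (Δ (fun y => g (f y))) x =
      g₂ * ∑ i, (fderiv ℝ f x (b i)) ^ 2 + g₁ (f x) * (Δ f) x := by
  have hf1 := eventually_differentiableAt_of_contDiffAt hf
  have hf2 := differentiableAt_fderiv_of_contDiffAt hf
  have hfU : ∀ᶠ y in 𝓝 x, f y ∈ U := hf.continuousAt.preimage_mem_nhds (hU.mem_nhds hfx)
  have heq : (fun y => g₁ (f y) • fderiv ℝ f y) =ᶠ[𝓝 x] fderiv ℝ (fun y => g (f y)) := by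
    filter_upwards [hf1, hfU] with y hfy hyU
    exact ((hg _ hyU).comp_hasFDerivAt y hfy.hasFDerivAt).fderiv.symm
  have hcomp : HasFDerivAt (fun y => g₁ (f y)) (g₂ • fderiv ℝ f x) x :=
    hg₁.comp_hasFDerivAt x hf1.self_of_nhds.hasFDerivAt
  have hL : HasFDerivAt (fderiv ℝ (fun y => g (f y)))
      (g₁ (f x) • fderiv ℝ (fderiv ℝ f) x + (g₂ • fderiv ℝ f x).smulRight (fderiv ℝ f x)) x :=
    (hcomp.smul hf2.hasFDerivAt).congr_of_eventuallyEq heq.symm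
  rw [laplacian_eq_sum_fderiv_fderiv_apply hL.differentiableAt b,
    laplacian_eq_sum_fderiv_fderiv_apply hf2 b, Finset.mul_sum, Finset.mul_sum,
    ← Finset.sum_add_distrib]
  refine Finset.sum_congr rfl fun i _ => ?_
  rw [← fderiv_fderiv_apply_eq_fderiv_apply hL.differentiableAt,
    ← fderiv_fderiv_apply_eq_fderiv_apply hf2, hL.fderiv]
  simp only [add_apply, smul_apply, ContinuousLinearMap.smulRight_apply, smul_eq_mul]
  ring

/-! ### Parseval for derivative sums -/

omit [FiniteDimensional ℝ E] in
/-- `Σᵢ ⟪v, bᵢ⟫ ⟪w, bᵢ⟫ = ⟪v, w⟫` for an orthonormal basis (Parseval). [folklore] -/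
theorem sum_inner_mul_inner_eq {ι : Type*} [Fintype ι] (b : OrthonormalBasis ι ℝ E) (v w : E) :
    ∑ i, ⟪v, b i⟫ * ⟪w, b i⟫ = ⟪v, w⟫ := by
  rw [← b.sum_inner_mul_inner v w]
  exact Finset.sum_congr rfl fun i _ => by rw [real_inner_comm (b i) w]

/-! ### The norm, a linear coordinate, and `c|x| − ⟪a, x⟫` -/

omit [FiniteDimensional ℝ E] in
/-- `D|·|(x) = |x|⁻¹ ⟪x, ·⟫` at `x ≠ 0`. [folklore] -/
theorem hasFDerivAt_norm_of_ne_zero {x : E} (hx : x ≠ 0) :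
    HasFDerivAt (fun y : E => ‖y‖) (‖x‖⁻¹ • (innerSL ℝ x : E →L[ℝ] ℝ)) x := by
  have hr : 0 < ‖x‖ := norm_pos_iff.mpr hx
  have h1 : HasDerivAt Real.sqrt (1 / (2 * Real.sqrt (‖x‖ ^ 2))) (‖x‖ ^ 2) :=
    Real.hasDerivAt_sqrt (pow_pos hr 2).ne'
  have h3 := hasFDerivAt_comp_norm_sq h1
  have hfun : (fun w : E => Real.sqrt (‖w‖ ^ 2)) = fun w => ‖w‖ := by
    funext w; rw [Real.sqrt_sq (norm_nonneg w)]
  rw [hfun, Real.sqrt_sq hr.le] at h3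
  have e : (2 : ℝ) * (1 / (2 * ‖x‖)) = ‖x‖⁻¹ := by field_simp
  rw [e] at h3
  exact h3

/-- **`Δ|x| = (n − 1)/|x|`** at `x ≠ 0`, `n = dim E` (`|x| = (|x|²)^{1/2}` and the radial formula
`Δ g(|x|²) = 4|x|² g'' + 2n g'`). [folklore] -/
theorem laplacian_norm {x : E} (hx : x ≠ 0) :
    (Δ (fun y : E => ‖y‖)) x = ((finrank ℝ E : ℝ) - 1) / ‖x‖ := by
  have hr : 0 < ‖x‖ := norm_pos_iff.mpr hx
  have hs : 0 < ‖x‖ ^ 2 := pow_pos hr 2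
  have hg : ∀ σ ∈ Ioi (0 : ℝ), HasDerivAt Real.sqrt (1 / (2 * Real.sqrt σ)) σ := fun σ hσ =>
    Real.hasDerivAt_sqrt (ne_of_gt hσ)
  have hsq : Real.sqrt (‖x‖ ^ 2) = ‖x‖ := Real.sqrt_sq hr.le
  have hg₁' : HasDerivAt (fun σ => (2 * Real.sqrt σ)⁻¹)
      (-(2 * (1 / (2 * Real.sqrt (‖x‖ ^ 2)))) / (2 * Real.sqrt (‖x‖ ^ 2)) ^ 2) (‖x‖ ^ 2) :=
    ((Real.hasDerivAt_sqrt hs.ne').const_mul 2).inv (by rw [hsq]; positivity)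
  have hg₁ : HasDerivAt (fun σ => 1 / (2 * Real.sqrt σ))
      (-(2 * (1 / (2 * ‖x‖))) / (2 * ‖x‖) ^ 2) (‖x‖ ^ 2) := by
    have hfe : (fun σ => 1 / (2 * Real.sqrt σ)) = fun σ => (2 * Real.sqrt σ)⁻¹ :=
      funext fun σ => one_div _
    rw [hfe]; rw [hsq] at hg₁'; exact hg₁'
  have hfun : (fun w : E => Real.sqrt (‖w‖ ^ 2)) = fun w => ‖w‖ := by
    funext w; rw [Real.sqrt_sq (norm_nonneg w)]
  have h := laplacian_comp_norm_sq (E := E) isOpen_Ioi hg hs hg₁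
  rw [hfun, hsq] at h
  rw [h]
  field_simp
  ring

/-- The Laplacian of a linear coordinate vanishes: `Δ⟪a, ·⟫ = 0` (its derivative is the constant
`⟪a, ·⟫`). [folklore] -/
theorem laplacian_inner_right (a x : E) : (Δ (fun y : E => ⟪a, y⟫)) x = 0 := by
  have hD : fderiv ℝ (fun y : E => ⟪a, y⟫) = fun _ => (innerSL ℝ a : E →L[ℝ] ℝ) := by
    funext y
    exact (innerSL ℝ a : E →L[ℝ] ℝ).fderiv
  rw [laplacian_eq_sum_fderiv_fderiv_apply (by rw [hD]; exact differentiableAt_const _)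
    (stdOrthonormalBasis ℝ E)]
  simp [hD]

omit [FiniteDimensional ℝ E] in
/-- `⟪a, ·⟫` is smooth. [folklore] -/
theorem contDiff_inner_right (a : E) {n : WithTop ℕ∞} : ContDiff ℝ n (fun y : E => ⟪a, y⟫) :=
  (innerSL ℝ a : E →L[ℝ] ℝ).contDiff

omit [FiniteDimensional ℝ E] in
/-- `c|·| − ⟪a, ·⟫` is smooth at every `x ≠ 0`. [folklore] -/
theorem contDiffAt_landauDen (c : ℝ) (a : E) {x : E} (hx : x ≠ 0) {n : WithTop ℕ∞} :
    ContDiffAt ℝ n (fun y : E => c * ‖y‖ - ⟪a, y⟫) x :=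
  (contDiffAt_const.mul (contDiffAt_norm ℝ hx)).sub (contDiff_inner_right a).contDiffAt

omit [FiniteDimensional ℝ E] in
/-- **Derivative of `c|x| − ⟪a, x⟫`**: `D(c|·| − ⟪a,·⟫)(x) = ⟪(c/|x|) x − a, ·⟫` at `x ≠ 0`. [folklore] -/
theorem hasFDerivAt_landauDen (c : ℝ) (a : E) {x : E} (hx : x ≠ 0) :
    HasFDerivAt (fun y : E => c * ‖y‖ - ⟪a, y⟫)
      (innerSL ℝ ((c * ‖x‖⁻¹) • x - a) : E →L[ℝ] ℝ) x := by
  have h := ((hasFDerivAt_norm_of_ne_zero hx).const_mul c).sub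
    (innerSL ℝ a : E →L[ℝ] ℝ).hasFDerivAt
  refine h.congr_fderiv ?_
  ext v
  simp only [sub_apply, smul_apply, innerSL_apply_apply, smul_eq_mul, inner_sub_left,
    inner_smul_left, RCLike.conj_to_real]
  ring

omit [FiniteDimensional ℝ E] in
/-- Unfolded directional form: `∂_v (c|·| − ⟪a,·⟫)(x) = ⟪(c/|x|) x − a, v⟫`. [folklore] -/
theorem fderiv_landauDen_apply (c : ℝ) (a : E) {x : E} (hx : x ≠ 0) (v : E) :
    fderiv ℝ (fun y : E => c * ‖y‖ - ⟪a, y⟫) x v = ⟪(c * ‖x‖⁻¹) • x - a, v⟫ := by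
  rw [(hasFDerivAt_landauDen c a hx).fderiv, innerSL_apply_apply]

/-- **`Δ(c|x| − ⟪a, x⟫) = c (n − 1)/|x|`** at `x ≠ 0`. [folklore] -/
theorem laplacian_landauDen (c : ℝ) (a : E) {x : E} (hx : x ≠ 0) :
    (Δ (fun y : E => c * ‖y‖ - ⟪a, y⟫)) x = c * (((finrank ℝ E : ℝ) - 1) / ‖x‖) := by
  have h1 : ContDiffAt ℝ 2 (fun y : E => c * ‖y‖) x := contDiffAt_const.mul (contDiffAt_norm ℝ hx)
  have h2 : ContDiffAt ℝ 2 (fun y : E => ⟪a, y⟫) x := (contDiff_inner_right a).contDiffAt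
  have hfun : (fun y : E => c * ‖y‖ - ⟪a, y⟫) = (fun y : E => c * ‖y‖) - fun y : E => ⟪a, y⟫ := rfl
  have hsm : (fun y : E => c * ‖y‖) = c • fun y : E => ‖y‖ := by
    funext y; simp [smul_eq_mul]
  rw [hfun, h1.laplacian_sub h2, laplacian_inner_right, sub_zero, hsm,
    InnerProductSpace.laplacian_smul c (contDiffAt_norm ℝ hx), laplacian_norm hx, smul_eq_mul]

/-! ### One-variable derivatives of `2/t` and `−2/t²` -/

omit [FiniteDimensional ℝ E] in
/-- `d/dt (2/t) = −2/t²` for `t ≠ 0`. [folklore] -/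
theorem hasDerivAt_two_div {t : ℝ} (ht : t ≠ 0) :
    HasDerivAt (fun s : ℝ => 2 / s) (-2 / t ^ 2) t := by
  have h := (hasDerivAt_inv ht).const_mul (2 : ℝ)
  have hfe : (fun s : ℝ => 2 / s) = fun s => 2 * s⁻¹ := funext fun s => div_eq_mul_inv 2 s
  rw [hfe]
  refine h.congr_deriv ?_
  field_simp

omit [FiniteDimensional ℝ E] in
/-- `d/dt (−2/t²) = 4/t³` for `t ≠ 0`. [folklore] -/
theorem hasDerivAt_neg_two_div_sq {t : ℝ} (ht : t ≠ 0) :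
    HasDerivAt (fun s : ℝ => -2 / s ^ 2) (4 / t ^ 3) t := by
  have h := ((hasDerivAt_id' t).fun_pow 2).fun_inv (pow_ne_zero 2 ht) |>.const_mul (-2 : ℝ)
  have hfe : (fun s : ℝ => -2 / s ^ 2) = fun s => -2 * (s ^ 2)⁻¹ :=
    funext fun s => div_eq_mul_inv _ _
  rw [hfe]
  refine h.congr_deriv ?_
  field_simp
  ring

/-! ### `β = 2/(c|x| − ⟪a, x⟫)` on `ℝ³ ∖ {0}`: derivative and `Δβ = β ∂ₐβ` -/

section Beta

variable {a : EuclideanSpace ℝ (Fin 3)} {c : ℝ} {x : EuclideanSpace ℝ (Fin 3)}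

/-- `Δ(c|x| − ⟪a, x⟫) = 2c/|x|` on `ℝ³ ∖ {0}`. [folklore] -/
theorem laplacian_landauDen_three (c : ℝ) (a : EuclideanSpace ℝ (Fin 3))
    {x : EuclideanSpace ℝ (Fin 3)} (hx : x ≠ 0) :
    (Δ (fun y : EuclideanSpace ℝ (Fin 3) => c * ‖y‖ - ⟪a, y⟫)) x = 2 * c / ‖x‖ := by
  rw [laplacian_landauDen c a hx, finrank_euclideanSpace_fin]
  push_cast
  ring

/-- **Derivative of `β = 2/(c|x| − ⟪a,x⟫)`** at `x ≠ 0` (unit axis `a`, `|c| > 1`):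
`Dβ(x) = −(2/(c|x| − ⟪a,x⟫)²) ⟪(c/|x|) x − a, ·⟫`. [folklore] -/
theorem hasFDerivAt_landauBeta (ha : ‖a‖ = 1) (hc : 1 < |c|) (hx : x ≠ 0) :
    HasFDerivAt (fun y : EuclideanSpace ℝ (Fin 3) => 2 / (c * ‖y‖ - ⟪a, y⟫))
      ((-2 / (c * ‖x‖ - ⟪a, x⟫) ^ 2) •
        (innerSL ℝ ((c * ‖x‖⁻¹) • x - a) : EuclideanSpace ℝ (Fin 3) →L[ℝ] ℝ)) x :=
  (hasDerivAt_two_div (landauAxis_denom_ne_zero ha hc hx)).comp_hasFDerivAt x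
    (hasFDerivAt_landauDen c a hx)

/-- Unfolded directional form: `∂_v β(x) = −(2/(c|x| − ⟪a,x⟫)²) ⟪(c/|x|) x − a, v⟫`. [folklore] -/
theorem fderiv_landauBeta_apply (ha : ‖a‖ = 1) (hc : 1 < |c|) (hx : x ≠ 0)
    (v : EuclideanSpace ℝ (Fin 3)) :
    fderiv ℝ (fun y : EuclideanSpace ℝ (Fin 3) => 2 / (c * ‖y‖ - ⟪a, y⟫)) x v =
      -2 / (c * ‖x‖ - ⟪a, x⟫) ^ 2 * ⟪(c * ‖x‖⁻¹) • x - a, v⟫ := by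
  rw [(hasFDerivAt_landauBeta ha hc hx).fderiv, smul_apply, innerSL_apply_apply, smul_eq_mul]

/-- `β` is smooth at every `x ≠ 0`. [folklore] -/
theorem contDiffAt_landauBeta (ha : ‖a‖ = 1) (hc : 1 < |c|) (hx : x ≠ 0) {n : WithTop ℕ∞} :
    ContDiffAt ℝ n (fun y : EuclideanSpace ℝ (Fin 3) => 2 / (c * ‖y‖ - ⟪a, y⟫)) x :=
  contDiffAt_const.div (contDiffAt_landauDen c a hx) (landauAxis_denom_ne_zero ha hc hx)

/-- `|(c/|x|) x − a|² = c² − 2c⟪a,x⟫/|x| + 1` for a unit vector `a` and `x ≠ 0`. [folklore] -/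
theorem norm_sq_landauGrad (ha : ‖a‖ = 1) (c : ℝ) (hx : x ≠ 0) :
    ‖(c * ‖x‖⁻¹) • x - a‖ ^ 2 = c ^ 2 - 2 * c * ⟪a, x⟫ / ‖x‖ + 1 := by
  have hr : ‖x‖ ≠ 0 := norm_ne_zero_iff.mpr hx
  rw [norm_sub_sq_real, norm_smul, inner_smul_left, real_inner_comm x a, ha, Real.norm_eq_abs,
    abs_mul, abs_inv, abs_norm, RCLike.conj_to_real]
  have h1 : (|c| * ‖x‖⁻¹ * ‖x‖) ^ 2 = c ^ 2 := by
    rw [mul_assoc, inv_mul_cancel₀ hr, mul_one, sq_abs]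
  rw [h1]
  field_simp

/-- `Σᵢ (∂ᵢ(c|·| − ⟪a,·⟫)(x))² = c² − 2c⟪a,x⟫/|x| + 1` over the standard basis of `ℝ³`
(Parseval for `∇(c|x| − ⟪a,x⟫) = (c/|x|) x − a`, `|a| = 1`). [folklore] -/
theorem sum_sq_fderiv_landauDen (ha : ‖a‖ = 1) (c : ℝ) (hx : x ≠ 0) :
    ∑ i, (fderiv ℝ (fun y : EuclideanSpace ℝ (Fin 3) => c * ‖y‖ - ⟪a, y⟫) x
        (EuclideanSpace.basisFun (Fin 3) ℝ i)) ^ 2 =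
      c ^ 2 - 2 * c * ⟪a, x⟫ / ‖x‖ + 1 := by
  simp_rw [fderiv_landauDen_apply c a hx]
  rw [← norm_sq_landauGrad ha c hx, ← real_inner_self_eq_norm_sq,
    ← sum_inner_mul_inner_eq (EuclideanSpace.basisFun (Fin 3) ℝ)]
  exact Finset.sum_congr rfl fun i _ => by ring

/-- **The key second-order identity `Δβ = β ∂ₐβ`** on `ℝ³ ∖ {0}` for
`β = 2/(c|x| − ⟪a,x⟫)`, `|a| = 1`, `|c| > 1`: both sides equal
`4(|x| − c⟪a,x⟫)/(|x| (c|x| − ⟪a,x⟫)³)` (chain rule with `g(t) = 2/t`, `Δ(c|x| − ⟪a,x⟫) = 2c/|x|`,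
`|∇(c|x| − ⟪a,x⟫)|² = c² + 1 − 2c⟪a,x⟫/|x|`). This is the only genuinely second-order
computation behind Landau's theorem. [folklore] -/
theorem laplacian_landauBeta (ha : ‖a‖ = 1) (hc : 1 < |c|) (hx : x ≠ 0) :
    (Δ (fun y : EuclideanSpace ℝ (Fin 3) => 2 / (c * ‖y‖ - ⟪a, y⟫))) x =
      (2 / (c * ‖x‖ - ⟪a, x⟫)) *
        fderiv ℝ (fun y : EuclideanSpace ℝ (Fin 3) => 2 / (c * ‖y‖ - ⟪a, y⟫)) x a := by
  have hD := landauAxis_denom_ne_zero ha hc hx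
  have hr : ‖x‖ ≠ 0 := norm_ne_zero_iff.mpr hx
  have hg : ∀ σ ∈ {t : ℝ | t ≠ 0},
      HasDerivAt (fun t : ℝ => 2 / t) ((fun t : ℝ => -2 / t ^ 2) σ) σ :=
    fun σ hσ => hasDerivAt_two_div hσ
  rw [laplacian_comp_deriv_apply (EuclideanSpace.basisFun (Fin 3) ℝ) (contDiffAt_landauDen c a hx)
      isOpen_ne hg hD (hasDerivAt_neg_two_div_sq hD),
    sum_sq_fderiv_landauDen ha c hx, laplacian_landauDen_three c a hx,
    fderiv_landauBeta_apply ha hc hx, inner_sub_left, inner_smul_left, real_inner_comm x a,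
    real_inner_self_eq_norm_sq, ha, RCLike.conj_to_real]
  field_simp
  ring

end Beta

end Summit.NavierStokesRegularity.NavierStokesRegularity.Theorems.LandauTail
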